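import Literature.MathematicalPhysics.QuantumFieldTheory.Balaban1983to89.B9Eq343HolderXiZdFinite
import Literature.MathematicalPhysics.QuantumFieldTheory.Balaban1983to89.B9GraphZdConnected
import Literature.MathematicalPhysics.QuantumFieldTheory.Balaban1983to89.B8CubeMemberLevelSep
import Literature.MathematicalPhysics.QuantumFieldTheory.Balaban1983to89.B9Eq347GlobalFromLocalZdUniform

/-!
# `Balaban1983to89.B9BlockLawsCubeMemberZd` — [Balaban1985RegularSpaces] (1.131) p. 99 («the sequence of cubes □_j … a distance between boundaries of these cubes is
# equal to R₁M₁Lʲη», p. 98) ∕ (1.5)–(1.6) p. 77, [Balaban1984PropagatorsII] (2.2) p. 224, Lemma 2.1 p. 234, [Balaban1985BackgroundPropagators] p. 397 (𝔅, Δ(y)):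
# THE CUBE MEMBER OF (1.131) SATISFIES THE BLOCK LAWS OF THE `ℤᵈ` LEMMA-2.1 CHAIN — (T) «level-j block ⊆ Ω_j», (G1′) «every site of Ω_j lies in a block of 𝔅», (G2′)
# «a level-j_y block meets Ω_j only for j ≤ j_y», the (2.2) separation `Sep22Zd R` for `R⌈M⌉ ≤ ρ`, `Ω₀` a finite box, 𝔅 finite, the block graph connected — so that
# dag-n06-w2's Lemma-2.1 ∕ Hölder chain (`B9Lemma21ShellCrossingZd`, `B9Lemma21RowLetterZd`, `B9GraphZdConnected`, `B9Eq347GlobalFromLocalZdUniform`,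
# `B9Eq343HolderXiZdFinite`) applies at print's cube tower with NO displayed geometric law

statement-level skeleton of published theorems with citation tags; proofs where landed; nothing here is a claim about the
Yang–Mills mass gap

PDF held: `paper:balaban1985-cmp99-regular-spaces-gauge-fixing` pp. 77, 98–99; `paper:balaban1985-cmp99-background-propagators` p. 397; [Balaban1984PropagatorsII] (2.2), Lemma 2.1 —
through the audited headers of `B8Eq131Cubes ∕ B8Eq131CubesAdmissible` (b08 lineage: `cube`, `sqLo ∕ sqHi ∕ inLo ∕ inHi`, `add_mem_cube_of_mem_succ`, `mem_cube_iff`),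
n05-c's `B8CubeMemberZd ∕ B8CubeMemberLevelSep` (`cubeLamS ∕ cubeLam`, `inBox_sq_of_mem_cubeLamS`, `inBox_inner_of_mem_cube_succ_of_under`), `B8LeafModelZd.ZdIdx`
(`htower ∕ hpart ∕ hΩ`), and dag-n06-w2 g2∕g3's chain — BY NAME.

WHY THIS FILE (cell `pub-ymgap`, HUMAN RULING D-0062 ∕ D-0149; seat `pub-ymgap-dag-n06-w2` (g3), node N06 = [B9]; CLAIM-6; count-neutral).  Every theorem of the `ℤᵈ` Lemma-2.1
chain displays the block laws (T), (G1′), (G2′), the separation `Sep22Zd R`, finiteness of `𝔅`, and connectivity of the block graph as HYPOTHESES on the member; nobody had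
discharged them at a concrete member.  This file does it for the member `(M, i, m)` of an index `i` presenting print's cube tower (`i.Ω = cubeFam false L a M_c ρ i.k`,
`i.Λs = cubeLamS L a M_c ρ i.k`, n05-c's `exists_member_cube`) at every truncation `m ≤ i.k`, and instantiates `holderAtδ2_zdXi_uniform` there.

WHAT IS PROVED (kernel, 0 sorry; proof lane — no `def`).
* §1 ★ `hT_cube` (T) · ★ `hlevel_cube` (G2′) · ★ `hcover_cube` (G1′, every `j ≤ m`) · `omega_zero_cube_eq_box` · `omega_zero_cube_finite` · `nonempty_bsite_cube` (from a site
  of `Ω_m`) · `bsite_set_finite_cube` ∕ ★ `finite_bsite_cube` (`𝔅` is finite).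
* §2 ★★ `sep22_cube` (`R·⌈M⌉₊ ≤ ρ` ⟹ `Sep22Zd R (memZd M i m)`: «□_j ⊃ □_{j+1} and a distance between boundaries of these cubes is equal to R₁M₁Lʲη») ·
  ★ `reachable_cube` (the block graph is connected: `preconnected_of_box`).
* §4 ★★ `weight_mul_norm_gop_le_unif_cube` · ★★ `weight_mul_norm_gradGop_le_unif_cube` — dag-n06-w2 g2's uniform (3.47)-from-(3.42) entries n = 0, 1 (`B9Eq347GlobalFromLocalZdUniform`,
  constant `B₀·L³·K261`) at the cube member with the block laws discharged.
* §3 ★★★ `holderAtδ2_zdXi_uniform_cube` — `B9Eq343HolderXiZdFinite.holderAtδ2_zdXi_uniform` at the cube member with EVERY geometric hypothesis discharged: what remains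
  displayed is the operator's linearity ∕ `Ω₀`-restriction, the numeric side conditions `R⌈M⌉₊ ≤ ρ`, `N₀ ≤ R⌈M⌉₊`, `3 log L ≤ κ₂R⌈M⌉₊`, and the typeclass instances
  `[Fintype 𝔅] [Nonempty 𝔅]` (inhabited by `finite_bsite_cube` ∕ `nonempty_bsite_cube` — any instances serve).
HONEST SCOPE.  Lattice geometry of the printed cube tower; no estimate of [B9]; (3.42)+(3.43)-at-Ξ remain the binder's inputs (Thm 3.3 content, NOT proved); count-neutral;
N05∕N06 NOT discharged; one finite lattice programme at fixed `ε`; R4 closes the conditional finite-𝕋⁴ rung `BalabanLadder.UV` only; nothing continuum ∕ ℝ⁴ ∕ OS ∕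
mass-gap ∕ Clay.  Unit `pub-ymgap-dag-n06-w2` (g3), 2026-08-28.
-/

noncomputable section

namespace Literature.MathematicalPhysics.QuantumFieldTheory.Balaban1983to89.B9BlockLawsCubeMemberZd

open B7Prop1Local (InBox)
open B7Prop2Explicit (unitaryUnits)
open B8Ineq132 (Under)
open B8LeafModelZd (ZdIdx)
open B8Eq131Cubes (cube sqLo sqHi inLo inHi flm mem_cube_iff cube_succ_subset)
open B8Eq131CubesAdmissible (cubeFam cubeFam_false_of_le cubeFam_false_zero add_mem_cube_of_mem_succ)
open B8CubeMemberZd (cubeLamS cubeLam cubeLamS_of_lt cubeLamS_self cubeLamS_top inBox_sq_of_mem_cubeLamS inBox_tower_iff_under)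
open B8CubeMemberLevelSep (inBox_inner_of_mem_cube_succ_of_under)
open B9SupplySockB9P3ZdLetters (OpsZd)
open B9SupplySockB9P3ZdLettersOmega (restrictDom)
open B9SupplySockB9P3ZdFrame (MemberZd memZd BSite blockZd mem_blockZd_iff graphZd distZd bigSideZd Sep22Zd bgZd ιCfgZd)
open B9SupplySockB9P3ZdFrameXi (geoZdXi GAZdXiFamOfOps)
open B9Lemma21ShellCrossingZd (Omega_antitone)
open B9GraphZdConnected (preconnected_of_box)
open B9Eq343HolderXiZdFinite (holderAtδ2_zdXi_uniform)
open B9SupplySockB9P3ZdLocalLettersOfOps (cdBZd GAZdOfOps)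
open B9Eq347GlobalFromLocalZd (extZd)
open B9Eq347GlobalFromLocalZdUniform (weight_mul_norm_gop_le_unif weight_mul_norm_gradGop_le_unif)
open B9SupplySockB9P3ZdFrame (CfgZd)
open B9SupplySockB9P3ZdGammaUnivDelta2 (HolderAtδ2)
open B6Ineq261LevelGap (K261)
open LatticeNorms (linfDist natAbs_sub_le_linfDist)

-- `Site` alone could resolve to the torus sites of `Setup.lean`; re-export the `ℤ^d` sites of `B7Prop1Explicit`.
export B7Prop1Explicit (Site)

variable {d L : ℕ}

/-! ## §1 The block laws (T), (G2′), (G1′), the box `Ω₀`, finiteness and non-emptiness of `𝔅` at the cube member -/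

section Laws

variable (hL : 1 ≤ L) (i : ZdIdx d L) {a : Site d} {Mc ρ : ℕ} (hΩ : i.Ω = cubeFam false L a Mc ρ i.k) (hΛs : i.Λs = cubeLamS L a Mc ρ i.k)
  (M : ℝ) {m : ℕ} (hm : m ≤ i.k)

include hΛs in
/-- a coarse site of `𝔅` at truncation `m` is a restriction site of the cube member at its level. [cite: Balaban1985RegularSpaces, (1.68) p.88, (1.131) p.99] -/
theorem mem_cubeLamS_of_bsite (y : BSite L (memZd M i m)) : y.1.2 ∈ cubeLamS L a Mc ρ i.k m y.1.1 := by
  have h : y.1.2 ∈ i.Λs m y.1.1 := y.2.2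
  rwa [hΛs] at h

include hL hΩ hΛs hm in
/-- ★ **(T) «THE LEVEL-`j` BLOCK OF A SITE OF `Λ_j` LIES IN `Ω_j`»** at the cube member: `Δ(y) = Bʲ(y) ⊆ □_j` for `y ∈ 𝔅` of level `j` (the coarse site lies in the
level-`j` trace `[sqLo j, sqHi j]` of `□_j`, which is a union of level-`j` blocks). [cite: Balaban1985RegularSpaces, (1.5)–(1.6) p.77, (1.131) p.99, p.98 («□_j is a sum of the big blocks»)] -/
theorem hT_cube : ∀ y : BSite L (memZd M i m), blockZd L y.1.1 y.1.2 ⊆ i.Ω y.1.1 := by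
  intro y z hz
  have hj : y.1.1 ≤ m := y.2.1
  have hsq := inBox_sq_of_mem_cubeLamS (mem_cubeLamS_of_bsite i hΛs M y)
  rw [hΩ, cubeFam_false_of_le L a Mc ρ (hj.trans hm), mem_cube_iff hL]
  exact ⟨y.1.2, hsq, (inBox_tower_iff_under L y.1.1 y.1.2 z).1 hz⟩

include hL hΩ hΛs hm in
/-- ★ **(G2′) «A LEVEL-`j_y` BLOCK MEETS `Ω_j` ONLY FOR `j ≤ j_y`»** at the cube member: below the truncation level the coarse sites of `Λ_{j_y}` avoid the trace
`[inLo, inHi]` of `□_{j_y+1}` (the second clause of `cubeLam`), and a level-`j_y` block meeting `□_{j_y+1}` would have its coarse site in that trace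
(`inBox_inner_of_mem_cube_succ_of_under`). [cite: Balaban1985RegularSpaces, (1.5) p.77 («Λ_j = Ω_j^{(j)} ∖ …»), (1.131) p.99; Balaban1984PropagatorsII, (2.3) p.224] -/
theorem hlevel_cube : ∀ (y : BSite L (memZd M i m)) (z : Site d), z ∈ blockZd L y.1.1 y.1.2 → ∀ j, j ≤ m → z ∈ i.Ω j → j ≤ y.1.1 := by
  intro y z hz j hjm hzj
  by_contra hlt
  have hlt' : y.1.1 < j := not_le.mp hlt
  have hjy : y.1.1 < m := lt_of_lt_of_le hlt' hjm
  have hjk : y.1.1 < i.k := lt_of_lt_of_le hjy hm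
  have hy : y.1.2 ∈ cubeLam L a Mc ρ i.k y.1.1 := by
    have h := mem_cubeLamS_of_bsite i hΛs M y
    rwa [cubeLamS_of_lt L a Mc ρ i.k hjy] at h
  -- `z ∈ Ω_j ⊆ Ω_{j_y+1} = □_{j_y+1}`
  have hz1 : z ∈ cube L a Mc ρ i.k (y.1.1 + 1) := by
    have h := Omega_antitone i (Nat.succ_le_of_lt hlt') hzj
    rwa [hΩ, cubeFam_false_of_le L a Mc ρ (Nat.succ_le_of_lt hjk)] at h
  have hU : Under L y.1.1 y.1.2 z := (inBox_tower_iff_under L y.1.1 y.1.2 z).1 hz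
  exact (hy.2 hjk) (inBox_inner_of_mem_cube_succ_of_under hL a Mc ρ hjk hU hz1)

include hL hΩ hΛs hm in
/-- ★ **(G1′) «EVERY SITE OF `Ω_j`, `j ≤ m`, LIES IN A BLOCK OF `𝔅`»** at the cube member: a site of `□_m` lies in a level-`m` block of the top trace (`Λs m m = [sqLo m, sqHi m]`);
a site of `□_j ∖ □_m` lies in a block of print's partition (`ZdIdx.hpart`) of some level `j′`, necessarily `j′ < m` (by (T) at the top truncation and `□_{j′} ⊆ □_m` otherwise),
where the truncated and untruncated restriction sets agree. [cite: Balaban1985RegularSpaces, (1.6) p.77, (1.68) p.88, (1.131) p.99] -/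
theorem hcover_cube : ∀ j, j ≤ m → ∀ z : Site d, z ∈ i.Ω j → ∃ y : BSite L (memZd M i m), z ∈ blockZd L y.1.1 y.1.2 := by
  intro j hjm z hz
  by_cases hzm : z ∈ cube L a Mc ρ i.k m
  · obtain ⟨w, hw, hU⟩ := (mem_cube_iff hL).1 hzm
    have hwΛ : w ∈ i.Λs m m := by rw [hΛs, cubeLamS_self]; exact hw
    exact ⟨⟨(m, w), le_rfl, hwΛ⟩, (inBox_tower_iff_under L m w z).2 hU⟩
  · have hz0 : z ∈ i.Ω 0 := Omega_antitone i (Nat.zero_le j) hz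
    obtain ⟨j', hj'k, y', hy', hyU⟩ := i.hpart z hz0
    have hj'm : j' < m := by
      by_contra hge
      have hge' : m ≤ j' := not_lt.mp hge
      have hzj' : z ∈ i.Ω j' := i.htower j' hj'k y' hy' z hyU
      have hzm' : z ∈ i.Ω m := Omega_antitone i hge' hzj'
      rw [hΩ, cubeFam_false_of_le L a Mc ρ hm] at hzm'
      exact hzm hzm'
    have hyΛ : y' ∈ i.Λs m j' := by
      have h : y' ∈ cubeLamS L a Mc ρ i.k i.k j' := by rw [← hΛs]; exact hy'
      rw [cubeLamS_top L a Mc ρ hj'k, ← cubeLamS_of_lt L a Mc ρ i.k hj'm] at h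
      rw [hΛs]; exact h
    exact ⟨⟨(j', y'), hj'm.le, hyΛ⟩, hyU⟩

include hΩ in
/-- **`Ω₀ = □₀` IS A BOX** (the top trace at level `0`). [cite: Balaban1985RegularSpaces, (1.131) p.99, p.98] -/
theorem omega_zero_cube_eq_box : i.Ω 0 = {z : Site d | InBox (sqLo L a ρ i.k 0) (sqHi L a Mc ρ i.k 0) z} := by
  rw [hΩ, cubeFam_false_zero]
  rfl

include hΩ in
/-- `Ω₀` of the cube member is finite. [cite: Balaban1985RegularSpaces, (1.131) p.99 (bookkeeping)] -/
theorem omega_zero_cube_finite : (i.Ω 0).Finite := by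
  rw [omega_zero_cube_eq_box i hΩ]
  exact B9Eq347GlobalFromLocalZd.finite_inBox _ _

include hL hΩ hΛs hm in
/-- `𝔅` at truncation `m` is non-empty as soon as `□_m` has a site. [cite: Balaban1985BackgroundPropagators, p.397 (𝔅; bookkeeping)] -/
theorem nonempty_bsite_cube (hne : (i.Ω m).Nonempty) : Nonempty (BSite L (memZd M i m)) := by
  obtain ⟨z, hz⟩ := hne
  obtain ⟨y, _⟩ := hcover_cube hL i hΩ hΛs M hm m le_rfl z hz
  exact ⟨y⟩

include hΛs in
/-- the index set of `𝔅` at truncation `m` is a finite set of pairs (levels `≤ m`, coarse sites in the level traces `[sqLo j, sqHi j]`).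
[cite: Balaban1985BackgroundPropagators, p.397 (𝔅 = ⋃_{j ≤ k} Λ_j; bookkeeping)] -/
theorem bsite_set_finite_cube : {p : ℕ × Site d | p.1 ≤ m ∧ p.2 ∈ i.Λs m p.1}.Finite := by
  have hbig : (⋃ j ∈ Finset.range (m + 1), ({j} : Set ℕ) ×ˢ {z : Site d | InBox (sqLo L a ρ i.k j) (sqHi L a Mc ρ i.k j) z}).Finite :=
    Set.Finite.biUnion (Finset.range (m + 1)).finite_toSet fun j _ =>
      (Set.finite_singleton j).prod (B9Eq347GlobalFromLocalZd.finite_inBox _ _)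
  refine hbig.subset ?_
  rintro ⟨j, z⟩ ⟨hj, hz⟩
  simp only [Set.mem_iUnion, Set.mem_prod, Set.mem_singleton_iff, Set.mem_setOf_eq, Finset.mem_range]
  refine ⟨j, Nat.lt_succ_of_le hj, rfl, ?_⟩
  have h : z ∈ cubeLamS L a Mc ρ i.k m j := by rw [← hΛs]; exact hz
  exact inBox_sq_of_mem_cubeLamS h

include hΛs in
/-- ★ **`𝔅` IS FINITE** at the cube member (every truncation). [cite: Balaban1985BackgroundPropagators, p.397 (𝔅; bookkeeping)] -/
theorem finite_bsite_cube : Finite (BSite L (memZd M i m)) :=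
  Set.finite_coe_iff.2 (bsite_set_finite_cube i hΛs (m := m))

end Laws

/-! ## §2 The (2.2) separation and the connectivity of the block graph at the cube member -/

section Separation

variable (hL : 1 ≤ L) (i : ZdIdx d L) {a : Site d} {Mc ρ : ℕ} (hΩ : i.Ω = cubeFam false L a Mc ρ i.k) (hΛs : i.Λs = cubeLamS L a Mc ρ i.k)
  (M : ℝ) {m : ℕ} (hm : m ≤ i.k)

include hΩ hm in
/-- ★★ **THE (2.2) SEPARATION `Sep22Zd R` HOLDS AT THE CUBE MEMBER WHEN `R·⌈M⌉ ≤ ρ`**: a site outside `□_j` and a site of `□_{j+1}` are MORE than `ρLʲ ≥ R⌈M⌉Lʲ` fine sites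
apart in the sup-distance — «□_j ⊃ □_{j+1} and a distance between boundaries of these cubes is equal to R₁M₁Lʲη» (`add_mem_cube_of_mem_succ`: the `ρLʲ`-collar of `□_{j+1}`
lies in `□_j`). [cite: Balaban1985RegularSpaces, p.98, (1.131) p.99; Balaban1984PropagatorsII, (2.2) p.224] -/
theorem sep22_cube {R : ℕ} (hR : R * ⌈M⌉₊ ≤ ρ) : Sep22Zd R (memZd M i m) := by
  intro j hj z hz z' hz'
  change z ∉ i.Ω j at hz
  change z' ∈ i.Ω (j + 1) at hz'
  change R * bigSideZd M L j < linfDist z z'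
  have hjk : j < i.k := lt_of_lt_of_le (Nat.lt_of_succ_le hj) hm
  rw [hΩ, cubeFam_false_of_le L a Mc ρ hjk.le] at hz
  rw [hΩ, cubeFam_false_of_le L a Mc ρ (Nat.succ_le_of_lt hjk)] at hz'
  by_contra hle
  have hle' : linfDist z z' ≤ R * bigSideZd M L j := not_lt.mp hle
  have hbound : R * bigSideZd M L j ≤ ρ * L ^ j := by
    unfold B9SupplySockB9P3ZdFrame.bigSideZd
    calc R * (⌈M⌉₊ * L ^ j) = (R * ⌈M⌉₊) * L ^ j := by ring
      _ ≤ ρ * L ^ j := Nat.mul_le_mul_right _ hR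
  have ht : ∀ μ, |(z - z') μ| ≤ ((ρ * L ^ j : ℕ) : ℤ) := by
    intro μ
    rw [Pi.sub_apply, Int.abs_eq_natAbs]
    exact_mod_cast ((natAbs_sub_le_linfDist z z' μ).trans hle').trans hbound
  have hmem := add_mem_cube_of_mem_succ hjk hz' ht
  rw [add_sub_cancel] at hmem
  exact hz hmem

include hL hΩ hΛs hm in
/-- ★ **THE BLOCK GRAPH OF THE CUBE MEMBER IS CONNECTED** ((T) + (G1′) at level `0` + `Ω₀` a box: dag-n06-w2 g2's `preconnected_of_box`).
[cite: Balaban1984PropagatorsII, Lemma 2.1 p.234 (the block graph), (2.46) p.231; Balaban1985RegularSpaces, (1.131) p.99] -/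
theorem reachable_cube : ∀ u v : BSite L (memZd M i m), (graphZd L (memZd M i m)).Reachable u v :=
  preconnected_of_box hL (hT_cube hL i hΩ hΛs M hm) (fun z hz => hcover_cube hL i hΩ hΛs M hm 0 (Nat.zero_le m) z hz)
    (omega_zero_cube_eq_box i hΩ)

end Separation

/-! ## §3 `HolderAtδ2` at the Ξ frame with the member-uniform constant, at the cube member, every geometric law discharged -/

section Holder

variable {𝔸 : Type} [CStarAlgebra 𝔸] [Nontrivial 𝔸]

open Classical in
/-- ★★★ **`HolderAtδ2` AT THE Ξ FRAME WITH PRINT'S MEMBER-UNIFORM CONSTANT, AT THE CUBE MEMBER OF (1.131)** — `B9Eq343HolderXiZdFinite.holderAtδ2_zdXi_uniform` with (T), (G1′), (G2′),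
`Sep22Zd R`, connectivity and the finiteness of `Ω₀` DISCHARGED by §1–§2; displayed: the letter record's linearity and `Ω₀`-restriction, the numeric side conditions
`R⌈M⌉₊ ≤ ρ`, `N₀ ≤ R⌈M⌉₊` (`N₀ ≥ 1`), `0 ≤ κ₂`, `3 log L ≤ κ₂R⌈M⌉₊`, and the instances `[Fintype 𝔅] [Nonempty 𝔅]` (inhabited by `finite_bsite_cube` ∕ `nonempty_bsite_cube`).
The constant: `CH δ₀ = max ((4^β+1)L³K) (2·4^β L³K)`, `K = K261 N₀ d L 1 (δ₀ − κ₂)`, in the summable regime. [cite: Balaban1984PropagatorsII, Lemma 2.1 (2.60)–(2.61) p.234, (2.2) p.224; Balaban1985BackgroundPropagators, (3.43) p.398 («ξ = L^{−j}»), Thm 3.3 p.399; Balaban1985RegularSpaces, (1.36) p.82, (1.59) p.86, Prop. 3 p.87, (1.131) p.99] -/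
theorem holderAtδ2_zdXi_uniform_cube (hL : 1 ≤ L) {len : Site d → ℝ} (hlen1 : ∀ v : Site d, 0 < len v → 1 ≤ len v)
    (hlen : ∀ z z' : Site d, (linfDist z z' : ℝ) ≤ len (z' - z)) {β : ℝ} (hβ0 : 0 ≤ β) (hβ1 : β < 1)
    (ops : ℝ → ZdIdx d L → ℕ → OpsZd d 𝔸) (M : ℝ) (i : ZdIdx d L) {a : Site d} {Mc ρ : ℕ}
    (hΩ : i.Ω = cubeFam false L a Mc ρ i.k) (hΛs : i.Λs = cubeLamS L a Mc ρ i.k) {m : ℕ} (hm : m ≤ i.k)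
    [Fintype (BSite L (memZd M i m))] [Nonempty (BSite L (memZd M i m))]
    {R : ℕ} (hR : R * ⌈M⌉₊ ≤ ρ) {κ₂ : ℝ} (hκ₂ : 0 ≤ κ₂) (hrate : 3 * Real.log L ≤ κ₂ * ((R : ℝ) * ⌈M⌉₊))
    {N₀ : ℕ} (hN₀ : 0 < N₀) (hMN : N₀ ≤ R * ⌈M⌉₊)
    (hlin : ∀ (U₀ : Site d → Fin d → 𝔸ˣ) (c : ℝ) (A B : Site d → Fin d → 𝔸),
      (ops M i m).Gop U₀ (c • A + B) = c • (ops M i m).Gop U₀ A + (ops M i m).Gop U₀ B)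
    (hrestrict : ∀ (U₀ : Site d → Fin d → 𝔸ˣ) (J : Site d → Fin d → 𝔸), (ops M i m).Gop U₀ J = (ops M i m).Gop U₀ (restrictDom (i.Ω 0) J)) :
    HolderAtδ2 (geoZdXi 𝔸 L len) (bgZd 𝔸 L) (GAZdXiFamOfOps 𝔸 L len ops) L memZd (ιCfgZd 𝔸 L) ops β len
      (fun δ₀ => if Real.exp (-(δ₀ - κ₂)) * (L : ℝ) ^ ((2 * d : ℝ) / N₀) < 1 then
          max (((4 : ℝ) ^ β + 1) * (L : ℝ) ^ 3 * K261 N₀ d L 1 (δ₀ - κ₂)) (2 * (4 : ℝ) ^ β * (L : ℝ) ^ 3 * K261 N₀ d L 1 (δ₀ - κ₂))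
        else max
          (((4 : ℝ) ^ β + 1) *
            ((Finset.univ.sup' Finset.univ_nonempty fun u : BSite L (memZd M i m) => 1 * ((L : ℝ) ^ u.1.1 * i.η) ^ 3) *
              (Finset.univ.sup' Finset.univ_nonempty fun v : BSite L (memZd M i m) => (((L : ℝ) ^ v.1.1 * i.η) ^ 3)⁻¹)) *
            (Fintype.card (BSite L (memZd M i m)) : ℝ))
          (2 * (4 : ℝ) ^ β *
            ((Finset.univ.sup' Finset.univ_nonempty fun u : BSite L (memZd M i m) => 1 * ((L : ℝ) ^ u.1.1 * i.η) ^ 3) *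
              (Finset.univ.sup' Finset.univ_nonempty fun v : BSite L (memZd M i m) => (((L : ℝ) ^ v.1.1 * i.η) ^ 3)⁻¹)) *
            (Fintype.card (BSite L (memZd M i m)) : ℝ))) M i m :=
  holderAtδ2_zdXi_uniform hL hlen1 hlen hβ0 hβ1 ops M i m (omega_zero_cube_finite i hΩ) (hT_cube hL i hΩ hΛs M hm)
    (hcover_cube hL i hΩ hΛs M hm) (hlevel_cube hL i hΩ hΛs M hm) (sep22_cube i hΩ M hm hR) (reachable_cube hL i hΩ hΛs M hm)
    hκ₂ hrate hN₀ hMN hlin hrestrict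

end Holder

/-! ## §4 The uniform (3.47)-from-(3.42) entries of dag-n06-w2 g2 at the cube member, block laws discharged -/

section Sup

variable {𝔸 : Type} [CStarAlgebra 𝔸]

/-- ★★ **ENTRY n = 0 WITH PRINT'S UNIFORM CONSTANT AT THE CUBE MEMBER**: `(Lʲη)·‖(G(U)f̃)(b)‖ ≤ B₀·L³·K261(N₀,d,L,1,δ₀−κ₂)·M` whenever `(L^{j_y}η)³‖f y‖ ≤ M` on the class —
g2's `weight_mul_norm_gop_le_unif` with (T), (G2′), `Sep22Zd`, connectivity supplied by §1–§2 (`R⌈M⌉₊ ≤ ρ`). [cite: Balaban1985BackgroundPropagators, (3.47) p.398 + l.17–20, (3.42) p.397; Balaban1984PropagatorsII, Lemma 2.1 (2.60)–(2.61) p.234; Balaban1985RegularSpaces, (1.131) p.99] -/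
theorem weight_mul_norm_gop_le_unif_cube (hL : 1 ≤ L) {len : Site d → ℝ} (M : ℝ) (i : ZdIdx d L) {a : Site d} {Mc ρ : ℕ}
    (hΩ : i.Ω = cubeFam false L a Mc ρ i.k) (hΛs : i.Λs = cubeLamS L a Mc ρ i.k) {m : ℕ} (hm : m ≤ i.k) [Fintype (BSite L (memZd M i m))]
    {R : ℕ} (hR : R * ⌈M⌉₊ ≤ ρ) {ops : OpsZd d 𝔸} {U : CfgZd d 𝔸} {B₀ δ₀ : ℝ} (hB₀ : 0 ≤ B₀)
    (h342 : B9.Ineq342_346_347 (GAZdOfOps 𝔸 L len (memZd M i m) ops) B₀ δ₀ U)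
    (hlin : ∀ (c : ℝ) (A B : Site d → Fin d → 𝔸), ops.Gop U.1 (c • A + B) = c • ops.Gop U.1 A + ops.Gop U.1 B)
    {P : Site d × Fin d → Prop} (π : {b : Site d × Fin d // P b} → BSite L (memZd M i m))
    (hπ : ∀ b, b.1.1 ∈ blockZd L (π b).1.1 (π b).1.2)
    {κ₂ : ℝ} (hκ₂ : 0 ≤ κ₂) (hrate : 3 * Real.log L ≤ κ₂ * ((R : ℝ) * ⌈M⌉₊))
    {N₀ : ℕ} (hN₀ : 0 < N₀) (hMN : N₀ ≤ R * ⌈M⌉₊) (hθ : Real.exp (-(δ₀ - κ₂)) * (L : ℝ) ^ ((2 * d : ℝ) / N₀) < 1)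
    (f : {b : Site d × Fin d // P b} → 𝔸) {Mb : ℝ} (hMb : 0 ≤ Mb) (hMf : ∀ y, ((L : ℝ) ^ (π y).1.1 * i.η) ^ 3 * ‖f y‖ ≤ Mb)
    (b : {b : Site d × Fin d // P b}) :
    ((L : ℝ) ^ (π b).1.1 * i.η) * ‖ops.Gop U.1 (extZd P f) b.1.1 b.1.2‖ ≤ B₀ * (L : ℝ) ^ 3 * K261 N₀ d L 1 (δ₀ - κ₂) * Mb :=
  weight_mul_norm_gop_le_unif (hT_cube hL i hΩ hΛs M hm) (hlevel_cube hL i hΩ hΛs M hm) hL (sep22_cube i hΩ M hm hR)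
    (reachable_cube hL i hΩ hΛs M hm) hB₀ h342 hlin π hπ hκ₂ hrate hN₀ hMN hθ f hMb hMf b

/-- ★★ **ENTRY n = 1 WITH PRINT'S UNIFORM CONSTANT AT THE CUBE MEMBER**: `(Lʲη)²·‖(∇_{U,ν}G(U)f̃)(b)‖ ≤ B₀·L³·K261(…)·M` — g2's `weight_mul_norm_gradGop_le_unif`, laws by §1–§2.
[cite: Balaban1985BackgroundPropagators, (3.47) p.398 + l.17–20, (3.42) p.397; Balaban1984PropagatorsII, Lemma 2.1 (2.60)–(2.61) p.234; Balaban1985RegularSpaces, (1.131) p.99] -/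
theorem weight_mul_norm_gradGop_le_unif_cube (hL : 1 ≤ L) {len : Site d → ℝ} (M : ℝ) (i : ZdIdx d L) {a : Site d} {Mc ρ : ℕ}
    (hΩ : i.Ω = cubeFam false L a Mc ρ i.k) (hΛs : i.Λs = cubeLamS L a Mc ρ i.k) {m : ℕ} (hm : m ≤ i.k) [Fintype (BSite L (memZd M i m))]
    {R : ℕ} (hR : R * ⌈M⌉₊ ≤ ρ) {ops : OpsZd d 𝔸} {U : CfgZd d 𝔸} {B₀ δ₀ : ℝ} (hB₀ : 0 ≤ B₀)
    (h342 : B9.Ineq342_346_347 (GAZdOfOps 𝔸 L len (memZd M i m) ops) B₀ δ₀ U)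
    (hlin : ∀ (c : ℝ) (A B : Site d → Fin d → 𝔸), ops.Gop U.1 (c • A + B) = c • ops.Gop U.1 A + ops.Gop U.1 B)
    {P : Site d × Fin d → Prop} (π : {b : Site d × Fin d // P b} → BSite L (memZd M i m))
    (hπ : ∀ b, b.1.1 ∈ blockZd L (π b).1.1 (π b).1.2)
    {κ₂ : ℝ} (hκ₂ : 0 ≤ κ₂) (hrate : 3 * Real.log L ≤ κ₂ * ((R : ℝ) * ⌈M⌉₊))
    {N₀ : ℕ} (hN₀ : 0 < N₀) (hMN : N₀ ≤ R * ⌈M⌉₊) (hθ : Real.exp (-(δ₀ - κ₂)) * (L : ℝ) ^ ((2 * d : ℝ) / N₀) < 1)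
    (ν : Fin d) (f : {b : Site d × Fin d // P b} → 𝔸) {Mb : ℝ} (hMb : 0 ≤ Mb) (hMf : ∀ y, ((L : ℝ) ^ (π y).1.1 * i.η) ^ 3 * ‖f y‖ ≤ Mb)
    (b : {b : Site d × Fin d // P b}) :
    ((L : ℝ) ^ (π b).1.1 * i.η) ^ 2 * ‖cdBZd i.η U.1 ν (ops.Gop U.1 (extZd P f)) b.1.1 b.1.2‖ ≤ B₀ * (L : ℝ) ^ 3 * K261 N₀ d L 1 (δ₀ - κ₂) * Mb :=
  weight_mul_norm_gradGop_le_unif (hT_cube hL i hΩ hΛs M hm) (hlevel_cube hL i hΩ hΛs M hm) hL (sep22_cube i hΩ M hm hR)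
    (reachable_cube hL i hΩ hΛs M hm) hB₀ h342 hlin π hπ hκ₂ hrate hN₀ hMN hθ ν f hMb hMf b

end Sup

end Literature.MathematicalPhysics.QuantumFieldTheory.Balaban1983to89.B9BlockLawsCubeMemberZd

end
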